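import Summits.Ventures.PercRepro.RankLevelSetDepCountHeavyWin

/-!
# PercRepro — THE WINDOWED HEAVY COUNT WITH THE FACTOR `|E ∖ UH|` (p8 g11, S3)

`proofs/SUBCLAIM-S3-p8.md` §3y. In the windowed heavy count `ncard_heavy_le_cap_window` (RankLevelSetDepCountHeavyWin) a
heavy rank-`q` set `B ⊆ insert x UH` with `B ⊄ UH` is split as `(B ∖ UH, B ∩ UH)`; its first part is the singleton `{x}`
and `x ∉ UH` — so the singleton ranges over `E ∖ UH`, not over `E`, and the third term of the count is
`(n − |UH|)·Σ_{q − 1 ≤ j ≤ c − 1} C(|UH|, j)` (`ncard_heavy_le_cap_window_factor`; no new matroid input). To use it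
with only `|UH| ≤ uH` known, the product `(n − u)·Σ_{lo ≤ j ≤ hi} C(u, j)` is monotone in `u` as long as
`u + 1 ≤ lo·(n − u)` (termwise, from `C(u, j)·(u + 1) = C(u + 1, j)·(u + 1 − j)`): `window_mul_mono` with
`5 ≤ lo` under `u′ ≤ 5·(n + 1 − u′)`. At the cells `(23, 8 … 12)` of the `q = 6` window (`uH = 12 … 18`,
`n = 31 … 35`) the `H`-term of the cell drops by the factor `(n − 5 − ν₁)/n ≈ 0.6`, `1.6 % … 10 %` of the room.
Axioms: standard.
-/

open scoped Matroid

namespace PercRepro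

namespace Matroid

open Set Finset

variable {α : Type} {M : _root_.Matroid α}

/-- **THE WINDOWED HEAVY COUNT WITH THE FACTOR `|E ∖ UH|`**: the heavy rank-`q` sets with at most `c` elements number
at most `Σ_{q ≤ j ≤ c} C(|UG|, j) + Σ_{q ≤ j ≤ c} C(|UH|, j) + (n − |UH|)·Σ_{q − 1 ≤ j ≤ c − 1} C(|UH|, j)`. -/
theorem ncard_heavy_le_cap_window_factor [M.Finite] (q ν₁ c : ℕ) :
    {B : Set α | B ⊆ M.E ∧ M.eRk B = (q : ℕ∞) ∧ q + ν₁ ≤ (M.closure B).ncard ∧ B.ncard ≤ c}.ncard ≤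
      ∑ j ∈ Finset.Icc q c, (UG M q ν₁).ncard.choose j +
        (∑ j ∈ Finset.Icc q c, (UH M q ν₁).ncard.choose j +
          (M.E.ncard - (UH M q ν₁).ncard) * ∑ j ∈ Finset.Icc (q - 1) (c - 1), (UH M q ν₁).ncard.choose j) := by
  classical
  have hUGE := UG_subset_ground (M := M) q ν₁
  have hUHE := UH_subset_ground (M := M) q ν₁
  have hUGfin : (UG M q ν₁).Finite := M.ground_finite.subset hUGE
  have hUHfin : (UH M q ν₁).Finite := M.ground_finite.subset hUHE
  have hDfin : (M.E \ UH M q ν₁).Finite := M.ground_finite.subset Set.sdiff_subset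
  -- a rank-`q` set has at least `q` elements
  have hq_le : ∀ B ⊆ M.E, M.eRk B = (q : ℕ∞) → q ≤ B.ncard := by
    intro B hB hr
    have h1 := M.eRk_le_encard B
    rw [hr] at h1
    have hBfin : B.Finite := M.ground_finite.subset hB
    rw [← hBfin.cast_ncard_eq] at h1
    exact_mod_cast h1
  set T₁ := {B : Set α | B ⊆ (hUGfin.toFinset : Set α) ∧ q ≤ B.ncard ∧ B.ncard ≤ c} with hT₁def
  set T₂ := {B : Set α | B ⊆ (hUHfin.toFinset : Set α) ∧ q ≤ B.ncard ∧ B.ncard ≤ c} with hT₂def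
  set T₃ := {B : Set α | B ⊆ M.E ∧ ¬ B ⊆ UH M q ν₁ ∧ (∃ x ∈ M.E, B ⊆ insert x (UH M q ν₁)) ∧
    q ≤ B.ncard ∧ B.ncard ≤ c} with hT₃def
  have hsub : {B : Set α | B ⊆ M.E ∧ M.eRk B = (q : ℕ∞) ∧ q + ν₁ ≤ (M.closure B).ncard ∧ B.ncard ≤ c} ⊆
      T₁ ∪ (T₂ ∪ T₃) := by
    intro B hB
    have hqB : q ≤ B.ncard := hq_le B hB.1 hB.2.1
    rcases heavy_subset hB.1 hB.2.1 hB.2.2.1 with h | h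
    · left
      refine ⟨?_, hqB, hB.2.2.2⟩
      rw [Set.Finite.coe_toFinset]
      exact h
    · right
      by_cases hBU : B ⊆ UH M q ν₁
      · left
        refine ⟨?_, hqB, hB.2.2.2⟩
        rw [Set.Finite.coe_toFinset]
        exact hBU
      · exact Or.inr ⟨hB.1, hBU, h, hqB, hB.2.2.2⟩
  have hT₁fin : T₁.Finite := (Finset.finite_toSet _).finite_subsets.subset (fun B hB => hB.1)
  have hT₂fin : T₂.Finite := (Finset.finite_toSet _).finite_subsets.subset (fun B hB => hB.1)
  have hT₃fin : T₃.Finite := M.ground_finite.finite_subsets.subset (fun B hB => hB.1)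
  have hT₁ : T₁.ncard ≤ ∑ j ∈ Finset.Icc q c, (UG M q ν₁).ncard.choose j := by
    have := ncard_subsets_ncard_window hUGfin.toFinset q c
    rwa [← Set.ncard_eq_toFinset_card _ hUGfin] at this
  have hT₂ : T₂.ncard ≤ ∑ j ∈ Finset.Icc q c, (UH M q ν₁).ncard.choose j := by
    have := ncard_subsets_ncard_window hUHfin.toFinset q c
    rwa [← Set.ncard_eq_toFinset_card _ hUHfin] at this
  -- the third class: the extra point lies OUTSIDE `UH`
  have hT₃ : T₃.ncard ≤ (M.E.ncard - (UH M q ν₁).ncard) *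
      ∑ j ∈ Finset.Icc (q - 1) (c - 1), (UH M q ν₁).ncard.choose j := by
    have hfin : ({X : Set α | X ⊆ (hDfin.toFinset : Set α) ∧ X.ncard = 1} ×ˢ
        {Y : Set α | Y ⊆ (hUHfin.toFinset : Set α) ∧ q - 1 ≤ Y.ncard ∧ Y.ncard ≤ c - 1}).Finite :=
      ((Finset.finite_toSet _).finite_subsets.subset (fun X hX => hX.1)).prod
        ((Finset.finite_toSet _).finite_subsets.subset (fun Y hY => hY.1))
    have hinj : T₃.ncard ≤ ({X : Set α | X ⊆ (hDfin.toFinset : Set α) ∧ X.ncard = 1} ×ˢ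
        {Y : Set α | Y ⊆ (hUHfin.toFinset : Set α) ∧ q - 1 ≤ Y.ncard ∧ Y.ncard ≤ c - 1}).ncard := by
      refine Set.ncard_le_ncard_of_injOn (fun B => (B \ UH M q ν₁, B ∩ UH M q ν₁)) ?_ ?_ hfin
      · intro B hB
        obtain ⟨hBE, hBU, ⟨x, _, hBx⟩, hqB, hBc⟩ := hB
        have hBfin : B.Finite := M.ground_finite.subset hBE
        have hsing : B \ UH M q ν₁ ⊆ {x} := by
          intro y hy
          rcases hBx hy.1 with h | h
          · exact h
          · exact absurd h hy.2
        have hne : (B \ UH M q ν₁).Nonempty := by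
          rw [Set.nonempty_iff_ne_empty]
          intro h0
          exact hBU (Set.sdiff_eq_empty.1 h0)
        have hX1 : (B \ UH M q ν₁).ncard = 1 := by
          have h1 : (B \ UH M q ν₁).ncard ≤ 1 :=
            (Set.ncard_le_ncard hsing (Set.finite_singleton x)).trans (by simp)
          have h2 : 1 ≤ (B \ UH M q ν₁).ncard := by
            rw [Nat.one_le_iff_ne_zero, Ne, Set.ncard_eq_zero (hBfin.subset Set.sdiff_subset)]
            exact Set.nonempty_iff_ne_empty.1 hne
          omega
        have hsplit : B.ncard = (B \ UH M q ν₁).ncard + (B ∩ UH M q ν₁).ncard := by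
          have hdis : Disjoint (B \ UH M q ν₁) (B ∩ UH M q ν₁) :=
            Set.disjoint_left.2 (fun y hy hy' => hy.2 hy'.2)
          rw [← Set.ncard_union_eq hdis (hBfin.subset Set.sdiff_subset)
            (hBfin.subset Set.inter_subset_left), Set.sdiff_union_inter]
        rw [Set.mem_prod]
        refine ⟨⟨?_, hX1⟩, ⟨?_, ?_, ?_⟩⟩
        · rw [Set.Finite.coe_toFinset]
          exact fun y hy => ⟨hBE hy.1, hy.2⟩
        · rw [Set.Finite.coe_toFinset]
          exact Set.inter_subset_right
        · show q - 1 ≤ (B ∩ UH M q ν₁).ncard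
          omega
        · show (B ∩ UH M q ν₁).ncard ≤ c - 1
          omega
      · intro B _ B' _ h
        simp only [Prod.mk.injEq] at h
        rw [← Set.sdiff_union_inter B (UH M q ν₁), ← Set.sdiff_union_inter B' (UH M q ν₁), h.1, h.2]
    rw [Set.ncard_prod] at hinj
    have h1 : {X : Set α | X ⊆ (hDfin.toFinset : Set α) ∧ X.ncard = 1}.ncard ≤
        M.E.ncard - (UH M q ν₁).ncard := by
      have := ncard_subsets_ncard_eq hDfin.toFinset 1
      rw [Nat.choose_one_right, ← Set.ncard_eq_toFinset_card _ hDfin, Set.ncard_sdiff' hUHE M.ground_finite] at this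
      exact this.le
    have h2 : {Y : Set α | Y ⊆ (hUHfin.toFinset : Set α) ∧ q - 1 ≤ Y.ncard ∧ Y.ncard ≤ c - 1}.ncard ≤
        ∑ j ∈ Finset.Icc (q - 1) (c - 1), (UH M q ν₁).ncard.choose j := by
      have := ncard_subsets_ncard_window hUHfin.toFinset (q - 1) (c - 1)
      rwa [← Set.ncard_eq_toFinset_card _ hUHfin] at this
    calc T₃.ncard ≤ _ := hinj
      _ ≤ (M.E.ncard - (UH M q ν₁).ncard) * ∑ j ∈ Finset.Icc (q - 1) (c - 1), (UH M q ν₁).ncard.choose j :=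
          Nat.mul_le_mul h1 h2
  calc _ ≤ (T₁ ∪ (T₂ ∪ T₃)).ncard := ncard_le_ncard hsub (hT₁fin.union (hT₂fin.union hT₃fin))
    _ ≤ T₁.ncard + (T₂ ∪ T₃).ncard := ncard_union_le _ _
    _ ≤ T₁.ncard + (T₂.ncard + T₃.ncard) := by
        gcongr
        exact ncard_union_le _ _
    _ ≤ _ := Nat.add_le_add hT₁ (Nat.add_le_add hT₂ hT₃)

/-- The termwise step of the monotonicity: `(n − u)·C(u, j) ≤ (n − u − 1)·C(u + 1, j)` when `u + 1 ≤ j·(n − u)`. -/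
theorem sub_mul_choose_le_succ (n u j : ℕ) (h : u + 1 ≤ j * (n - u)) :
    (n - u) * u.choose j ≤ (n - u - 1) * (u + 1).choose j := by
  rcases Nat.lt_or_ge u j with hlt | hle
  · -- `j > u`: `C(u, j) = 0`
    rw [Nat.choose_eq_zero_of_lt hlt, mul_zero]
    exact Nat.zero_le _
  · have hmul := Nat.choose_mul_succ_eq u j
    -- multiply the claim by `u + 1 > 0`
    have key : (n - u) * u.choose j * (u + 1) ≤ (n - u - 1) * (u + 1).choose j * (u + 1) := by
      have hineq : (n - u) * (u + 1 - j) ≤ (n - u - 1) * (u + 1) := by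
        have hj1 : j ≤ u + 1 := by omega
        have h' : u + 1 ≤ (n - u) * j := by rwa [mul_comm] at h
        have hnu : 1 ≤ n - u := by
          rcases Nat.eq_zero_or_pos (n - u) with h0 | h0
          · rw [h0, zero_mul] at h'; omega
          · exact h0
        have e1 : (n - u) * (u + 1 - j) + (n - u) * j = (n - u) * (u + 1) := by
          rw [← Nat.mul_add, Nat.sub_add_cancel hj1]
        have e2 : (n - u - 1) * (u + 1) + (u + 1) = (n - u) * (u + 1) := by
          rw [← Nat.succ_mul, Nat.succ_eq_add_one, Nat.sub_add_cancel hnu]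
        omega
      calc (n - u) * u.choose j * (u + 1)
          = (n - u) * ((u + 1).choose j * (u + 1 - j)) := by rw [mul_assoc, hmul]
        _ = (n - u) * (u + 1 - j) * (u + 1).choose j := by ring
        _ ≤ (n - u - 1) * (u + 1) * (u + 1).choose j := Nat.mul_le_mul_right _ hineq
        _ = (n - u - 1) * (u + 1).choose j * (u + 1) := by ring
    exact Nat.le_of_mul_le_mul_right key (by omega)

/-- **The monotonicity of the window product**: for `u ≤ u′ ≤ 5·(n + 1 − u′)` and a window starting at `lo ≥ 5`,
`(n − u)·Σ_{lo ≤ j ≤ hi} C(u, j) ≤ (n − u′)·Σ_{lo ≤ j ≤ hi} C(u′, j)`. -/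
theorem window_mul_mono (n lo hi u u' : ℕ) (hlo : 5 ≤ lo) (huu : u ≤ u') (h5 : u' ≤ 5 * (n + 1 - u')) :
    (n - u) * ∑ j ∈ Finset.Icc lo hi, u.choose j ≤ (n - u') * ∑ j ∈ Finset.Icc lo hi, u'.choose j := by
  obtain ⟨t, rfl⟩ : ∃ t, u' = u + t := ⟨u' - u, by omega⟩
  clear huu
  induction t with
  | zero => simp
  | succ t ih =>
    rw [show u + (t + 1) = u + t + 1 from rfl] at h5 ⊢
    have h5' : u + t ≤ 5 * (n + 1 - (u + t)) := by
      have : n + 1 - (u + t + 1) ≤ n + 1 - (u + t) := Nat.sub_le_sub_left (by omega) _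
      omega
    refine (ih h5').trans ?_
    rw [Finset.mul_sum, Finset.mul_sum]
    apply Finset.sum_le_sum
    intro j hj
    rw [Finset.mem_Icc] at hj
    have hstep : u + t + 1 ≤ j * (n - (u + t)) := by
      have h1 : u + t + 1 ≤ 5 * (n - (u + t)) := by
        have e : n + 1 - (u + t + 1) = n - (u + t) := by omega
        rw [e] at h5
        exact h5
      have h2 : 5 * (n - (u + t)) ≤ j * (n - (u + t)) := Nat.mul_le_mul_right _ (hlo.trans hj.1)
      exact h1.trans h2
    have := sub_mul_choose_le_succ n (u + t) j hstep
    have e : n - (u + t + 1) = n - (u + t) - 1 := by omega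
    rw [e]
    exact this

end Matroid

end PercRepro
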